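import Mathlib
import HarnessLib
import Summits.RiemannHypothesis.RiemannHypothesis.Theorems.IntegerScrewPsiDeriv
import Summits.RiemannHypothesis.RiemannHypothesis.Theorems.IntegerScrewPsiSmallArgPieces
import Summits.RiemannHypothesis.RiemannHypothesis.Theorems.IntegerScrewPsiSmallArg

/-!
# Tail of the top-block pairing inequality — calculus of the edge terms and bounds on `Ψ′, Ψ″, Ψ‴`

Support file for the kernel import of `TopBlockPairingNeg 31` (column SCREW, engine A; director-rh
I l.7143).  For an edge `(a, b)` and a real top node `N > 2b − a` put `u(N) = log(N − a) − log(N − b)`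
and `h(N) = N·Ψ(u(N))` (`Ψ = zetaScrew`, prime-free for `u < log 2`).  This file provides the explicit
first three derivatives of `u` and `h` (`hasDerivAt_edgeH`, `…H1`, `…H2`, from `hasDerivAt_zetaScrew`,
`hasDerivAt_zetaScrewDeriv`, `hasDerivAt_zetaScrewDeriv2`), two-sided brackets of `Ψ′` and `Ψ″` on
`(0, 2]` from the small-argument pieces, and the sup bounds `|Ψ′(s)| ≤ log(1/s)/2 + 3`,
`|Ψ″(s)| ≤ 1/(2s) + 4`, `|Ψ‴(s)| ≤ 1/s² + 1` on `(0, 1/2]`.  Nothing here bears on the truth of RH.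
-/

set_option autoImplicit false
set_option linter.dupNamespace false

noncomputable section

open scoped Topology
open Real Filter Set

namespace Summit.RiemannHypothesis.RiemannHypothesis.Theorems.IntegerScrew

open Literature.NumberTheory.LFunctions

/-! ## Calculus of the edge terms `h(N) = N · Ψ(log(N − a) − log(N − b))` -/
section EdgeCalc

/-- The log-lag of an edge seen from the (real) top node `N`: `u(N) = log(N − a) − log(N − b)`. [folklore] -/
def edgeU (a b : ℕ) (N : ℝ) : ℝ := Real.log (N - a) - Real.log (N - b)

/-- `u′(N) = 1/(N − a) − 1/(N − b)`. [folklore] -/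
def edgeU1 (a b : ℕ) (N : ℝ) : ℝ := 1 / (N - a) - 1 / (N - b)

/-- `u″(N) = −1/(N − a)² + 1/(N − b)²`. [folklore] -/
def edgeU2 (a b : ℕ) (N : ℝ) : ℝ := -1 / (N - a) ^ 2 + 1 / (N - b) ^ 2

/-- `u‴(N) = 2/(N − a)³ − 2/(N − b)³`. [folklore] -/
def edgeU3 (a b : ℕ) (N : ℝ) : ℝ := 2 / (N - a) ^ 3 - 2 / (N - b) ^ 3

variable {a b : ℕ} {N : ℝ}

/-- Derivative of `u`. [folklore] -/
theorem hasDerivAt_edgeU (hN : (b : ℝ) < N) (hab : a ≤ b) : HasDerivAt (edgeU a b) (edgeU1 a b N) N := by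
  have hab' : (a : ℝ) ≤ b := by exact_mod_cast hab
  have ha : (0 : ℝ) < N - a := by linarith
  have hb : (0 : ℝ) < N - b := by linarith
  have h1 := ((hasDerivAt_id N).sub_const (a : ℝ)).log ha.ne'
  have h2 := ((hasDerivAt_id N).sub_const (b : ℝ)).log hb.ne'
  have h := h1.sub h2
  refine (h.congr_of_eventuallyEq (Filter.Eventually.of_forall fun y => ?_)).congr_deriv ?_
  · simp [edgeU]
  · simp [edgeU1, id]

/-- Derivative of `u′`. [folklore] -/
theorem hasDerivAt_edgeU1 (hN : (b : ℝ) < N) (hab : a ≤ b) : HasDerivAt (edgeU1 a b) (edgeU2 a b N) N := by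
  have hab' : (a : ℝ) ≤ b := by exact_mod_cast hab
  have ha : (0 : ℝ) < N - a := by linarith
  have hb : (0 : ℝ) < N - b := by linarith
  have h1 := ((hasDerivAt_id N).sub_const (a : ℝ)).inv ha.ne'
  have h2 := ((hasDerivAt_id N).sub_const (b : ℝ)).inv hb.ne'
  have h := h1.sub h2
  refine (h.congr_of_eventuallyEq (Filter.Eventually.of_forall fun y => ?_)).congr_deriv ?_
  · simp [edgeU1, one_div]
  · simp only [edgeU2, id]; field_simp; ring

/-- Derivative of `u″`. [folklore] -/
theorem hasDerivAt_edgeU2 (hN : (b : ℝ) < N) (hab : a ≤ b) : HasDerivAt (edgeU2 a b) (edgeU3 a b N) N := by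
  have hab' : (a : ℝ) ≤ b := by exact_mod_cast hab
  have ha : (0 : ℝ) < N - a := by linarith
  have hb : (0 : ℝ) < N - b := by linarith
  have h1 : HasDerivAt (fun y : ℝ => (y - a) ^ 2) (2 * (N - a)) N := by
    have h := ((hasDerivAt_id N).sub_const (a : ℝ)).pow 2
    simp only [id] at h
    refine (h.congr_of_eventuallyEq (Filter.Eventually.of_forall fun y => by simp)).congr_deriv ?_
    push_cast; ring
  have h2 : HasDerivAt (fun y : ℝ => (y - b) ^ 2) (2 * (N - b)) N := by
    have h := ((hasDerivAt_id N).sub_const (b : ℝ)).pow 2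
    simp only [id] at h
    refine (h.congr_of_eventuallyEq (Filter.Eventually.of_forall fun y => by simp)).congr_deriv ?_
    push_cast; ring
  have h1' := h1.inv (pow_ne_zero 2 ha.ne')
  have h2' := h2.inv (pow_ne_zero 2 hb.ne')
  have h := h1'.neg.add h2'
  refine (h.congr_of_eventuallyEq (Filter.Eventually.of_forall fun y => ?_)).congr_deriv ?_
  · simp [edgeU2, one_div, neg_div]
  · simp only [edgeU3]
    field_simp
    ring

/-- `0 < u(N) < log 2` for `N > 2b − a`, `a < b`. [folklore] -/
theorem edgeU_pos_lt (hab : a < b) (hN : (2 * b : ℝ) - a < N) :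
    0 < edgeU a b N ∧ edgeU a b N < Real.log 2 := by
  have hab' : (a : ℝ) < b := by exact_mod_cast hab
  have hb : (0 : ℝ) < N - b := by linarith
  have ha : (0 : ℝ) < N - a := by linarith
  unfold edgeU
  rw [← Real.log_div ha.ne' hb.ne']
  constructor
  · apply Real.log_pos
    rw [lt_div_iff₀ hb]
    linarith
  · apply Real.log_lt_log (div_pos ha hb)
    rw [div_lt_iff₀ hb]
    linarith

/-- The edge term `h(N) = N · Ψ(u(N))`. [folklore] -/
def edgeH (a b : ℕ) (N : ℝ) : ℝ := N * zetaScrew (edgeU a b N)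

/-- `h′`. [folklore] -/
def edgeH1 (a b : ℕ) (N : ℝ) : ℝ :=
  zetaScrew (edgeU a b N) + N * (zetaScrewDeriv (edgeU a b N) * edgeU1 a b N)

/-- `h″`. [folklore] -/
def edgeH2 (a b : ℕ) (N : ℝ) : ℝ :=
  2 * (zetaScrewDeriv (edgeU a b N) * edgeU1 a b N)
    + N * (zetaScrewDeriv2 (edgeU a b N) * edgeU1 a b N ^ 2 + zetaScrewDeriv (edgeU a b N) * edgeU2 a b N)

/-- `h‴`. [folklore] -/
def edgeH3 (a b : ℕ) (N : ℝ) : ℝ :=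
  3 * (zetaScrewDeriv2 (edgeU a b N) * edgeU1 a b N ^ 2 + zetaScrewDeriv (edgeU a b N) * edgeU2 a b N)
    + N * (zetaScrewDeriv3 (edgeU a b N) * edgeU1 a b N ^ 3
      + 3 * zetaScrewDeriv2 (edgeU a b N) * edgeU1 a b N * edgeU2 a b N
      + zetaScrewDeriv (edgeU a b N) * edgeU3 a b N)

/-- Derivative of `h`. [folklore] -/
theorem hasDerivAt_edgeH (hab : a < b) (hN : (2 * b : ℝ) - a < N) :
    HasDerivAt (edgeH a b) (edgeH1 a b N) N := by
  have hab' : (a : ℝ) < b := by exact_mod_cast hab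
  have hbN : (b : ℝ) < N := by linarith
  obtain ⟨hu0, hu2⟩ := edgeU_pos_lt hab hN
  have hu := hasDerivAt_edgeU hbN hab.le
  have hz := (hasDerivAt_zetaScrew hu0 hu2).comp N hu
  have h := (hasDerivAt_id N).mul hz
  refine (h.congr_of_eventuallyEq (Filter.Eventually.of_forall fun y => ?_)).congr_deriv ?_
  · simp [edgeH, Function.comp]
  · simp only [edgeH1, id, Function.comp_apply]; ring

/-- Derivative of `h′`. [folklore] -/
theorem hasDerivAt_edgeH1 (hab : a < b) (hN : (2 * b : ℝ) - a < N) :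
    HasDerivAt (edgeH1 a b) (edgeH2 a b N) N := by
  have hab' : (a : ℝ) < b := by exact_mod_cast hab
  have hbN : (b : ℝ) < N := by linarith
  obtain ⟨hu0, hu2⟩ := edgeU_pos_lt hab hN
  have hu := hasDerivAt_edgeU hbN hab.le
  have hu1 := hasDerivAt_edgeU1 hbN hab.le
  have hz := (hasDerivAt_zetaScrew hu0 hu2).comp N hu
  have hz1 := (hasDerivAt_zetaScrewDeriv hu0).comp N hu
  have h := hz.add ((hasDerivAt_id N).mul (hz1.mul hu1))
  refine (h.congr_of_eventuallyEq (Filter.Eventually.of_forall fun y => ?_)).congr_deriv ?_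
  · simp [edgeH1, Function.comp]
  · simp only [edgeH2, id, Function.comp_apply, Pi.mul_apply]; ring

/-- Derivative of `h″`. [folklore] -/
theorem hasDerivAt_edgeH2 (hab : a < b) (hN : (2 * b : ℝ) - a < N) :
    HasDerivAt (edgeH2 a b) (edgeH3 a b N) N := by
  have hab' : (a : ℝ) < b := by exact_mod_cast hab
  have hbN : (b : ℝ) < N := by linarith
  obtain ⟨hu0, hu2⟩ := edgeU_pos_lt hab hN
  have hu := hasDerivAt_edgeU hbN hab.le
  have hu1 := hasDerivAt_edgeU1 hbN hab.le
  have hu2' := hasDerivAt_edgeU2 hbN hab.le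
  have hz1 := (hasDerivAt_zetaScrewDeriv hu0).comp N hu
  have hz2 := (hasDerivAt_zetaScrewDeriv2 hu0).comp N hu
  have h := ((hz1.mul hu1).const_mul 2).add
    ((hasDerivAt_id N).mul ((hz2.mul (hu1.pow 2)).add (hz1.mul hu2')))
  refine (h.congr_of_eventuallyEq (Filter.Eventually.of_forall fun y => ?_)).congr_deriv ?_
  · simp [edgeH2, Function.comp]
  · simp only [edgeH3, id, Function.comp_apply, Pi.mul_apply, Pi.add_apply, Pi.pow_apply]; push_cast; ring

end EdgeCalc

/-! ## Brackets and sup bounds for `Ψ′`, `Ψ″`, `Ψ‴` on small arguments -/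
section TailBounds

/-- Crude bracket of the constant `β − 1/2 = log 2 + π/4 − κ/2 ∈ [−7/5, −1]`. [folklore] -/
theorem zetaScrewSlope_sub_half_bounds :
    -(7 : ℝ) / 5 ≤ zetaScrewSlope - 1 / 2 ∧ zetaScrewSlope - 1 / 2 ≤ -1 := by
  have hγ1 := Real.one_half_lt_eulerMascheroniConstant
  have hγ2 := Real.eulerMascheroniConstant_lt_two_thirds
  have hπ1 := Real.pi_gt_d2
  have hπ2 := Real.pi_lt_d2
  have hl1 := Real.log_two_gt_d9
  have hl2 := Real.log_two_lt_d9
  have hlπ1 : 1 < Real.log Real.pi := by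
    rw [← Real.exp_lt_exp, Real.exp_log Real.pi_pos]
    have := Real.exp_one_lt_d9; linarith
  have hlπ2 : Real.log Real.pi < 2 * Real.log 2 := by
    have h4 : Real.log Real.pi < Real.log 4 := Real.log_lt_log Real.pi_pos (by linarith [Real.pi_lt_four])
    have : Real.log 4 = 2 * Real.log 2 := by
      rw [show (4 : ℝ) = 2 ^ 2 by norm_num, Real.log_pow]; norm_num
    linarith
  unfold zetaScrewSlope
  constructor <;> nlinarith

/-- Two-sided bracket of `Ψ'` on `(0, 2]` from the piece bounds. [folklore] -/
theorem zetaScrewDeriv_bracket {s : ℝ} (h0 : 0 < s) (h2 : s ≤ 2) :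
    -(Real.log s) / 2 + (zetaScrewSlope - 1 / 2) + 7 / 4 * s + (s ^ 2 / 96 + s ^ 3 / 12 - s ^ 4 / 3200 - s ^ 5 / 800)
      ≤ zetaScrewDeriv s ∧
    zetaScrewDeriv s ≤ -(Real.log s) / 2 + (zetaScrewSlope - 1 / 2) + 7 / 4 * s
      + (s ^ 2 / 96 + 3 / 32 * s ^ 3 + s ^ 4 / 12800 + 17 / 12000 * s ^ 5) := by
  rw [zetaScrewDeriv_eq_pieces]
  obtain ⟨a1, a2⟩ := hypPiece_bounds h0.le h2
  obtain ⟨b1, b2⟩ := atanPiece_bounds h0.le h2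
  obtain ⟨c1, c2⟩ := logPiece_bounds h0 h2
  constructor <;> nlinarith

/-- Sup bound: `|Ψ'(s)| ≤ log(1/s)/2 + 3` for `0 < s ≤ 1/2`. [folklore] -/
theorem abs_zetaScrewDeriv_le {s : ℝ} (h0 : 0 < s) (h1 : s ≤ 1 / 2) :
    |zetaScrewDeriv s| ≤ Real.log (1 / s) / 2 + 3 := by
  obtain ⟨lo, hi⟩ := zetaScrewDeriv_bracket h0 (by linarith)
  obtain ⟨k1, k2⟩ := zetaScrewSlope_sub_half_bounds
  have hlog : Real.log (1 / s) = -Real.log s := by rw [one_div, Real.log_inv]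
  have hlpos : 0 ≤ -Real.log s := by
    rw [← Real.log_inv]; exact Real.log_nonneg (by rw [le_inv_comm₀ (by norm_num) h0]; linarith)
  rw [hlog, abs_le]
  have hs2 : s ^ 2 ≤ 1 / 4 := by nlinarith
  have hs3 : s ^ 3 ≤ 1 / 8 := by nlinarith
  have hs4 : 0 ≤ s ^ 4 := by positivity
  have hs5 : s ^ 5 ≤ 1 / 32 := by nlinarith
  have hs5' : 0 ≤ s ^ 5 := by positivity
  constructor <;> nlinarith

/-- Two-sided bracket of `Ψ''` on `(0, 2]`:
`Ψ'' = (c − 2) + 7/4 − 1/(2s) + f₃' + f₂'`, `c = e^{s/2} + e^{−s/2}`. [folklore] -/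
theorem zetaScrewDeriv2_bracket {s : ℝ} (h0 : 0 < s) (h2 : s ≤ 2) :
    7 / 4 - 1 / (2 * s) + (s / 48 - s ^ 3 / 800) ≤ zetaScrewDeriv2 s ∧
    zetaScrewDeriv2 s ≤ 7 / 4 - 1 / (2 * s) + ((s / 2) ^ 2 + 5 / 48 * (s / 2) ^ 4)
      + (s / 48 + s ^ 3 / 3200) + (s ^ 2 / 32 + s ^ 4 / 1200) := by
  have hx : |s / 2| ≤ 1 := by rw [abs_of_nonneg (by linarith)]; linarith
  obtain ⟨c1, c2⟩ := exp_add_exp_neg_sub_two_bounds hx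
  obtain ⟨l1, l2⟩ := logPieceDeriv_bounds h0 h2
  obtain ⟨a1, a2⟩ := atanPieceDeriv_bounds h0.le h2
  have hid : zetaScrewDeriv2 s = (Real.exp (s / 2) + Real.exp (-(s / 2)) - 2) + 7 / 4 - 1 / (2 * s)
      + logPieceDeriv s + atanPieceDeriv s := by
    unfold zetaScrewDeriv2 logPieceDeriv atanPieceDeriv
    ring
  rw [hid]
  constructor <;> nlinarith

/-- Sup bound: `|Ψ''(s)| ≤ 1/(2s) + 4` for `0 < s ≤ 2`. [folklore] -/
theorem abs_zetaScrewDeriv2_le {s : ℝ} (h0 : 0 < s) (h2 : s ≤ 2) :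
    |zetaScrewDeriv2 s| ≤ 1 / (2 * s) + 4 := by
  obtain ⟨lo, hi⟩ := zetaScrewDeriv2_bracket h0 h2
  have hs : 0 ≤ 1 / (2 * s) := by positivity
  rw [abs_le]
  have q2 : (s / 2) ^ 2 ≤ 1 := by nlinarith
  have q4 : (s / 2) ^ 4 ≤ 1 := by nlinarith
  constructor <;> nlinarith [pow_pos h0 3, pow_pos h0 4, pow_pos h0 2]

/-- Algebraic core of the `Ψ‴` bound with opaque `w = e^{−s/2}`, `D = e^{s/2} − e^{−s/2}`. [folklore] -/
theorem psi3_core {s w D : ℝ} (h0 : 0 < s) (hsD : s ≤ D) (hD1 : D ≤ 1) (hw34 : 3 / 4 ≤ w)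
    (hDw : 1 - w ^ 2 = D * w) :
    |(D + w) / 2 - w / 2 + w * (1 + w ^ 2) / (4 * (1 - w ^ 2) ^ 2) + w * (1 - w ^ 2) / (4 * (1 + w ^ 2) ^ 2)|
      ≤ 1 / s ^ 2 + 1 := by
  have hw0 : 0 < w := by linarith
  have hD0 : 0 < D := by linarith
  rw [hDw]
  have e1 : (D + w) / 2 - w / 2 = D / 2 := by ring
  have e2 : w * (1 + w ^ 2) / (4 * (D * w) ^ 2) = (1 + w ^ 2) / (4 * w * D ^ 2) := by
    field_simp
  rw [e1, e2]
  have t1 : 0 ≤ D / 2 := by linarith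
  have t1' : D / 2 ≤ 1 / 2 := by linarith
  have t2 : 0 ≤ (1 + w ^ 2) / (4 * w * D ^ 2) := by positivity
  have hs2 : 0 < s ^ 2 := pow_pos h0 2
  have h3s2 : 0 < 3 * s ^ 2 := by positivity
  have hnum : 1 + w ^ 2 ≤ 2 := by nlinarith
  have hden : 3 * s ^ 2 ≤ 4 * w * D ^ 2 := by
    have hd2 : s ^ 2 ≤ D ^ 2 := by nlinarith
    calc 3 * s ^ 2 ≤ 3 * D ^ 2 := by nlinarith
      _ ≤ 4 * w * D ^ 2 := by nlinarith [pow_pos hD0 2]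
  have t2' : (1 + w ^ 2) / (4 * w * D ^ 2) ≤ 1 / s ^ 2 :=
    (div_le_div₀ (by norm_num) hnum h3s2 hden).trans (by rw [div_le_div_iff₀ h3s2 hs2]; nlinarith)
  have t3 : 0 ≤ w * (D * w) / (4 * (1 + w ^ 2) ^ 2) := by positivity
  have t3' : w * (D * w) / (4 * (1 + w ^ 2) ^ 2) ≤ 1 / 4 := by
    have hnum' : w * (D * w) ≤ 1 := by nlinarith [hDw]
    have hden' : (4 : ℝ) ≤ 4 * (1 + w ^ 2) ^ 2 := by nlinarith [pow_pos hw0 2]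
    exact div_le_div₀ (by norm_num) hnum' (by norm_num) hden'
  rw [abs_le]
  have : 0 ≤ 1 / s ^ 2 := by positivity
  constructor <;> linarith

/-- Sup bound: `|Ψ‴(s)| ≤ 1/s² + 1` for `0 < s ≤ 1/2`. [folklore] -/
theorem abs_zetaScrewDeriv3_le {s : ℝ} (h0 : 0 < s) (h1 : s ≤ 1 / 2) :
    |zetaScrewDeriv3 s| ≤ 1 / s ^ 2 + 1 := by
  have hprod : Real.exp (s / 2) * Real.exp (-(s / 2)) = 1 := by rw [← Real.exp_add]; simp
  obtain ⟨hdlo, hdhi⟩ := exp_sub_exp_neg_bounds h0.le (by linarith)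
  have hs5 : s ^ 5 / 1600 ≤ s ^ 3 / 24 := by
    have : s ^ 2 ≤ 4 := by nlinarith
    have h35 : s ^ 5 = s ^ 3 * s ^ 2 := by ring
    rw [div_le_div_iff₀ (by norm_num) (by norm_num), h35]
    nlinarith [pow_pos h0 3, mul_le_mul_of_nonneg_left this (pow_pos h0 3).le]
  have hsD : s ≤ Real.exp (s / 2) - Real.exp (-(s / 2)) := by linarith
  have hD1 : Real.exp (s / 2) - Real.exp (-(s / 2)) ≤ 1 := by
    have h2 : s ^ 2 ≤ 1 / 4 := by nlinarith
    have h3 : s ^ 3 ≤ 1 / 8 := by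
      have := mul_le_mul h2 h1 h0.le (by norm_num); nlinarith
    have h5 : s ^ 5 ≤ 1 / 32 := by
      have := mul_le_mul h3 h2 (by positivity) (by norm_num); nlinarith
    linarith
  have hw34 : 3 / 4 ≤ Real.exp (-(s / 2)) := by
    have h1' : Real.exp (-(1 / 4 : ℝ)) ≤ Real.exp (-(s / 2)) := Real.exp_le_exp.2 (by linarith)
    have h2' : (3 : ℝ) / 4 ≤ Real.exp (-(1 / 4 : ℝ)) := by
      have := Real.add_one_le_exp (-(1 / 4 : ℝ)); linarith
    linarith
  have hw1 : Real.exp (-(s / 2)) ≤ 1 := by rw [Real.exp_le_one_iff]; linarith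
  have hDw : 1 - Real.exp (-(s / 2)) ^ 2 = (Real.exp (s / 2) - Real.exp (-(s / 2))) * Real.exp (-(s / 2)) := by
    rw [sub_mul, hprod]; ring
  have hE : Real.exp (s / 2) = (Real.exp (s / 2) - Real.exp (-(s / 2))) + Real.exp (-(s / 2)) := by ring
  have key := psi3_core h0 hsD hD1 hw34 hDw
  unfold zetaScrewDeriv3
  rw [hE]
  convert key using 2


end TailBounds

end Summit.RiemannHypothesis.RiemannHypothesis.Theorems.IntegerScrew

end
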